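import Mathlib
import Literature.Analysis.Complex.KthRootChart
import HarnessLib

/-!
# Solving for the rotated branch of a `k`-fold normal form (Wendl 2020, App. B, Lemma B.35)

Dimension four, in the `C¹` chart variable `s` of the normal form `u = (sᵏ, û(s))`
(`Literature/Geometry/Symplectic/JHolomorphicKthRootNormalForm.lean`). Let `X x : ℂ →L[ℝ] ℂ × ℂ`
be a normal frame satisfying the estimates of Lemma B.32
(`Literature/Geometry/Symplectic/JNormalPushoff.lean`):
`‖X_x w - (0,w)‖ ≤ C_X |x.2| |w|` and `‖X_x w - X_{x'} w‖ ≤ C_X ‖x - x'‖ |w|` on a ball, let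
`û` satisfy `|û(w)| ≤ C_u |w|^{k+1}` and `|û(w) - û(w')| ≤ C_u (2r)^k |w - w'|` for `|w|,|w'| ≤ 2r`,
and let `ε̄ᵏ = 1`, `|ε̄| = 1`. For every `s ≠ 0` small we solve Wendl's equation (B.20) for the
branch `θ ≈ ε̄ s` (NOT the trivial branch `θ = s`):

  `θᵏ + X̌_η(θᵏ, û θ) = sᵏ`,   `û(θ) + X̂_η(θᵏ, û θ) = û(s)`,

with `|θ - ε̄ s| ≤ |s|^{k+2}` and `|η| ≤ b |s|^{k+1}` (`exists_branchSolution`), as the unique fixed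
point in this box of the contraction

  `T_s(θ, η) = (ε̄ s · ᵏ√(1 - X̌_η(p)/sᵏ), û(s) - û(θ) - (X̂_η(p) - η))`,  `p = (θᵏ, û θ)`

(`ᵏ√` the principal branch near `1` from `Literature/Analysis/Complex/KthRootChart.lean`). This is
the existence part of Wendl 2020, Lemma B.35 (there obtained from a cylindrical rescaling and
`C¹`-convergence of local diffeomorphisms, Lemmas B.34–B.35), in the quantitative fixed-point form
needed for the rotation comparison `û(s)` vs `û(ε̄ s)` in the proof of Prop. B.41. Brick B3d
(parts D1–D2) of the blueprint for `Literature.Geometry.Symplectic.jHolomorphic_localBranchDichotomy`.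

Everything is proved; no named facts.

## References

* C. Wendl, *Lectures on Contact 3-Manifolds, Holomorphic Curves and Intersection Theory*,
  Cambridge Tracts in Math. 220 (2020), App. B, (B.20), Lemmas B.31–B.35, §B.2.5. [Wendl2020]
* M. Micallef, B. White, *The structure of branch points in minimal surfaces and in
  pseudoholomorphic curves*, Ann. of Math. 141 (1995), §6. [MicallefWhite1995]
-/

noncomputable section

open scoped Topology ContDiff
open Set Filter Metric Function Complex

namespace Literature.Geometry.Symplectic.RotationBranch

open Literature.Analysis.Complex.KthRootChart

/-! ### D1. The `k`-th root branch near `ε̄ s` -/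

/-- The principal `k`-th root `ᵏ√w = exp (log w / k)`. [folklore] -/
def kroot (k : ℕ) (w : ℂ) : ℂ := exp (log w / k)

/-- `ᵏ√1 = 1`. [folklore] -/
@[simp] theorem kroot_one (k : ℕ) : kroot k 1 = 1 := by simp [kroot]

/-- The root branch `root(s, a) = ε̄ s ᵏ√((sᵏ - a)/sᵏ)` of `θᵏ = sᵏ - a` near `θ = ε̄ s`.
[cite: Wendl2020, App. B, proof of Lemma B.35] -/
def root (k : ℕ) (εb s a : ℂ) : ℂ := εb * s * kroot k ((s ^ k - a) / s ^ k)

/-- `root(s, 0) = ε̄ s`. [folklore] -/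
theorem root_zero (k : ℕ) (εb : ℂ) {s : ℂ} (hs : s ≠ 0) : root k εb s 0 = εb * s := by
  simp [root, div_self (pow_ne_zero k hs)]

/-- `root(s,a)ᵏ = sᵏ - a` (when `ε̄ᵏ = 1`, `s ≠ 0`, `a ≠ sᵏ`). [folklore] -/
theorem root_pow {k : ℕ} (hk : k ≠ 0) {εb : ℂ} (hε : εb ^ k = 1) {s a : ℂ} (hs : s ≠ 0)
    (ha : s ^ k - a ≠ 0) : root k εb s a ^ k = s ^ k - a := by
  have hsk : s ^ k ≠ 0 := pow_ne_zero k hs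
  rw [root, mul_pow, mul_pow, hε, one_mul, kroot, exp_log_div_pow hk (div_ne_zero ha hsk)]
  field_simp

/-- **Lipschitz control of the root branch.** With the constants `L, δ` of
`exists_kthRoot_lipschitz`: for `s ≠ 0`, `|ε̄| = 1` and `|a|, |a'| < δ |s|ᵏ`,
`|root(s,a) - root(s,a')| ≤ L |s|^{1-k} |a - a'|` (written without negative powers).
[folklore] -/
theorem norm_root_sub_root_le {k : ℕ} {L δ : ℝ}
    (hLip : ∀ w ∈ ball (1 : ℂ) δ, ∀ w' ∈ ball (1 : ℂ) δ,
      ‖kroot k w - kroot k w'‖ ≤ L * ‖w - w'‖)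
    {εb : ℂ} (hεn : ‖εb‖ = 1) {s a a' : ℂ} (hs : s ≠ 0) (ha : ‖a‖ < δ * ‖s‖ ^ k)
    (ha' : ‖a'‖ < δ * ‖s‖ ^ k) :
    ‖root k εb s a - root k εb s a'‖ * ‖s‖ ^ k ≤ L * ‖s‖ * ‖a - a'‖ := by
  have hsk : s ^ k ≠ 0 := pow_ne_zero k hs
  have hnsk : 0 < ‖s‖ ^ k := by positivity
  have hmem : ∀ {b : ℂ}, ‖b‖ < δ * ‖s‖ ^ k → (s ^ k - b) / s ^ k ∈ ball (1 : ℂ) δ := by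
    intro b hb
    rw [mem_ball, dist_eq_norm, sub_div, div_self hsk, sub_sub_cancel_left, norm_neg, norm_div,
      norm_pow, div_lt_iff₀ hnsk]
    exact hb
  have h := hLip _ (hmem ha) _ (hmem ha')
  have hdiff : (s ^ k - a) / s ^ k - (s ^ k - a') / s ^ k = -(a - a') / s ^ k := by
    field_simp; ring
  rw [hdiff, norm_div, norm_neg, norm_pow] at h
  have hroot : root k εb s a - root k εb s a' =
      εb * s * (kroot k ((s ^ k - a) / s ^ k) - kroot k ((s ^ k - a') / s ^ k)) := by
    simp only [root]; ring
  rw [hroot, norm_mul, norm_mul, hεn, one_mul]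
  calc ‖s‖ * ‖kroot k ((s ^ k - a) / s ^ k) - kroot k ((s ^ k - a') / s ^ k)‖ * ‖s‖ ^ k
      ≤ ‖s‖ * (L * (‖a - a'‖ / ‖s‖ ^ k)) * ‖s‖ ^ k := by gcongr
    _ = L * ‖s‖ * ‖a - a'‖ := by field_simp

/-- The Lipschitz form of `exists_kthRoot_lipschitz`: `ᵏ√` is `L`-Lipschitz on `B(1,δ)`.
[folklore] -/
theorem exists_kroot_lipschitz (k : ℕ) :
    ∃ L δ : ℝ, 0 ≤ L ∧ 0 < δ ∧ δ ≤ 1 ∧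
      (∀ w ∈ ball (1 : ℂ) δ, ∀ w' ∈ ball (1 : ℂ) δ, ‖kroot k w - kroot k w'‖ ≤ L * ‖w - w'‖) ∧
      ContDiffOn ℝ ∞ (kroot k) (ball (1 : ℂ) δ) := by
  obtain ⟨L, δ, hL, hδ, hδ1, -, hD⟩ := exists_kthRoot_lipschitz k
  have hdiff : ∀ w ∈ ball (1 : ℂ) δ, DifferentiableAt ℝ (kroot k) w := fun w hw =>
    (contDiffAt_kthRoot k (ball_one_subset_slitPlane_of_le hδ1 hw) (n := 1)).differentiableAt
      one_ne_zero
  refine ⟨L, δ, hL, hδ, hδ1, fun w hw w' hw' => ?_, fun w hw =>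
    (contDiffAt_kthRoot k (ball_one_subset_slitPlane_of_le hδ1 hw)).contDiffWithinAt⟩
  have := (convex_ball (1 : ℂ) δ).norm_image_sub_le_of_norm_fderiv_le (𝕜 := ℝ)
    (f := kroot k) (fun w hw => hdiff w hw) (fun w hw => hD w hw) hw' hw
  simpa [kroot] using this

/-! ### D2. The contraction `T_s` and its invariant box -/

section Contraction

variable (k : ℕ) (εb : ℂ) (uh : ℂ → ℂ) (X : ℂ × ℂ → ℂ →L[ℝ] ℂ × ℂ)

/-- The point `p(θ) = (θᵏ, û θ)` on the `k`-fold curve. [cite: Wendl2020, App. B, (B.20)] -/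
def pt (θ : ℂ) : ℂ × ℂ := (θ ^ k, uh θ)

/-- Wendl's fixed-point map `T_s(θ, η) = (root(s, X̌_η(p θ)), û s - û θ - (X̂_η(p θ) - η))`.
[cite: Wendl2020, App. B, (B.20) and Lemma B.35] -/
def Tmap (s : ℂ) (v : ℂ × ℂ) : ℂ × ℂ :=
  (root k εb s (X (pt k uh v.1) v.2).1, uh s - uh v.1 - ((X (pt k uh v.1) v.2).2 - v.2))

/-- The box `|θ - ε̄ s| ≤ |s|^{k+2}`, `|η| ≤ b |s|^{k+1}`. [cite: Wendl2020, App. B, Lemma B.31] -/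
def box (b : ℝ) (s : ℂ) : Set (ℂ × ℂ) :=
  closedBall (εb * s) (‖s‖ ^ (k + 2)) ×ˢ closedBall (0 : ℂ) (b * ‖s‖ ^ (k + 1))

variable {k εb uh X}

/-- Membership in the box. [folklore] -/
theorem mem_box {b : ℝ} {s : ℂ} {v : ℂ × ℂ} :
    v ∈ box k εb b s ↔ ‖v.1 - εb * s‖ ≤ ‖s‖ ^ (k + 2) ∧ ‖v.2‖ ≤ b * ‖s‖ ^ (k + 1) := by
  simp [box, mem_closedBall, dist_eq_norm]

/-- The box is closed. [folklore] -/
theorem isClosed_box (b : ℝ) (s : ℂ) : IsClosed (box k εb b s) :=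
  isClosed_closedBall.prod isClosed_closedBall

/-- A fixed point of `T_s` solves Wendl's equations (B.20):
`θᵏ + X̌_η(p θ) = sᵏ` and `û θ + X̂_η(p θ) = û s`. [cite: Wendl2020, App. B, (B.20)] -/
theorem equations_of_fixedPoint (hk : k ≠ 0) (hε : εb ^ k = 1) {s : ℂ} (hs : s ≠ 0) {v : ℂ × ℂ}
    (hfix : Tmap k εb uh X s v = v) (ha : s ^ k - (X (pt k uh v.1) v.2).1 ≠ 0) :
    v.1 ^ k + (X (pt k uh v.1) v.2).1 = s ^ k ∧ uh v.1 + (X (pt k uh v.1) v.2).2 = uh s := by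
  have h1 : root k εb s (X (pt k uh v.1) v.2).1 = v.1 := congrArg Prod.fst hfix
  have h2 : uh s - uh v.1 - ((X (pt k uh v.1) v.2).2 - v.2) = v.2 := congrArg Prod.snd hfix
  constructor
  · have := root_pow hk hε hs ha
    rw [h1] at this
    rw [this]; ring
  · linear_combination -h2

/-- **Box estimates.** Pointwise bounds for `(θ, η)` in the box, under explicit smallness
conditions on `r = |s|`. [cite: Wendl2020, App. B, Lemmas B.31–B.33] -/
theorem box_pointwise {Cu ρ₁ CX δX b : ℝ} (hCu : 0 ≤ Cu) (hCX : 0 ≤ CX)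
    (hu0 : ∀ w ∈ ball (0 : ℂ) ρ₁, ‖uh w‖ ≤ Cu * ‖w‖ ^ (k + 1))
    (hX1 : ∀ x ∈ closedBall (0 : ℂ × ℂ) δX, ∀ w, ‖X x w - (0, w)‖ ≤ CX * ‖x.2‖ * ‖w‖)
    (hεn : ‖εb‖ = 1) {s : ℂ} (hr1 : ‖s‖ ≤ 1 / 2) (hrρ : 4 * ‖s‖ < ρ₁)
    (hrδ1 : (2 * ‖s‖) ^ k ≤ δX) (hrδ2 : Cu * (2 * ‖s‖) ^ (k + 1) ≤ δX)
    {v : ℂ × ℂ} (hv : v ∈ box k εb b s) :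
    ‖v.1‖ ≤ 2 * ‖s‖ ∧ ‖s‖ / 2 ≤ ‖v.1‖ ∧ v.1 ∈ ball (0 : ℂ) ρ₁ ∧
      ‖(pt k uh v.1).2‖ ≤ Cu * (2 * ‖s‖) ^ (k + 1) ∧ pt k uh v.1 ∈ closedBall (0 : ℂ × ℂ) δX ∧
      ‖(X (pt k uh v.1) v.2).1‖ ≤ CX * (Cu * (2 * ‖s‖) ^ (k + 1)) * (b * ‖s‖ ^ (k + 1)) ∧
      ‖(X (pt k uh v.1) v.2).2 - v.2‖ ≤ CX * (Cu * (2 * ‖s‖) ^ (k + 1)) * (b * ‖s‖ ^ (k + 1)) := by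
  obtain ⟨hθ, hη⟩ := mem_box.1 hv
  set r : ℝ := ‖s‖ with hr
  have hr0 : 0 ≤ r := norm_nonneg s
  have hεs : ‖εb * s‖ = r := by rw [norm_mul, hεn, one_mul]
  have hrk2 : r ^ (k + 2) ≤ r / 2 := by
    have h1 : r ^ (k + 1) ≤ 1 / 2 := by
      calc r ^ (k + 1) ≤ r ^ 1 := pow_le_pow_of_le_one hr0 (by linarith) (by omega)
        _ ≤ 1 / 2 := by rw [pow_one]; exact hr1
    calc r ^ (k + 2) = r ^ (k + 1) * r := by ring
      _ ≤ 1 / 2 * r := by gcongr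
      _ = r / 2 := by ring
  have hθup : ‖v.1‖ ≤ 2 * r := by
    calc ‖v.1‖ = ‖(v.1 - εb * s) + εb * s‖ := by rw [sub_add_cancel]
      _ ≤ ‖v.1 - εb * s‖ + ‖εb * s‖ := norm_add_le _ _
      _ ≤ r / 2 + r := by rw [hεs]; exact add_le_add (hθ.trans hrk2) le_rfl
      _ ≤ 2 * r := by linarith
  have hθlo : r / 2 ≤ ‖v.1‖ := by
    have : ‖εb * s‖ - ‖v.1 - εb * s‖ ≤ ‖v.1‖ := by
      have := norm_sub_norm_le (εb * s) (εb * s - v.1)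
      rw [sub_sub_cancel, norm_sub_rev] at this
      linarith
    rw [hεs] at this
    linarith [hθ.trans hrk2]
  have hθball : v.1 ∈ ball (0 : ℂ) ρ₁ := by
    rw [mem_ball, dist_zero_right]; linarith
  have hp2 : ‖(pt k uh v.1).2‖ ≤ Cu * (2 * r) ^ (k + 1) := by
    show ‖uh v.1‖ ≤ _
    calc ‖uh v.1‖ ≤ Cu * ‖v.1‖ ^ (k + 1) := hu0 _ hθball
      _ ≤ Cu * (2 * r) ^ (k + 1) := by gcongr
  have hpmem : pt k uh v.1 ∈ closedBall (0 : ℂ × ℂ) δX := by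
    rw [mem_closedBall, dist_zero_right, pt, Prod.norm_mk, max_le_iff, norm_pow]
    exact ⟨(pow_le_pow_left₀ (norm_nonneg _) hθup k).trans hrδ1, hp2.trans hrδ2⟩
  have hXb : ‖X (pt k uh v.1) v.2 - (0, v.2)‖ ≤ CX * (Cu * (2 * r) ^ (k + 1)) * (b * r ^ (k + 1)) := by
    calc ‖X (pt k uh v.1) v.2 - (0, v.2)‖ ≤ CX * ‖(pt k uh v.1).2‖ * ‖v.2‖ := hX1 _ hpmem _
      _ ≤ CX * (Cu * (2 * r) ^ (k + 1)) * (b * r ^ (k + 1)) := by gcongr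
  refine ⟨hθup, hθlo, hθball, hp2, hpmem, ?_, ?_⟩
  · calc ‖(X (pt k uh v.1) v.2).1‖ = ‖(X (pt k uh v.1) v.2 - (0, v.2)).1‖ := by simp
      _ ≤ ‖X (pt k uh v.1) v.2 - (0, v.2)‖ := norm_fst_le _
      _ ≤ _ := hXb
  · calc ‖(X (pt k uh v.1) v.2).2 - v.2‖ = ‖(X (pt k uh v.1) v.2 - (0, v.2)).2‖ := by simp
      _ ≤ ‖X (pt k uh v.1) v.2 - (0, v.2)‖ := norm_snd_le _
      _ ≤ _ := hXb

end Contraction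

/-- `‖aᵏ - bᵏ‖ ≤ k Mᵏ⁻¹ ‖a - b‖` for `‖a‖, ‖b‖ ≤ M`. [folklore] -/
theorem norm_pow_sub_pow_le {a b : ℂ} {M : ℝ} (ha : ‖a‖ ≤ M) (hb : ‖b‖ ≤ M) (k : ℕ) :
    ‖a ^ k - b ^ k‖ ≤ k * M ^ (k - 1) * ‖a - b‖ := by
  have hM : 0 ≤ M := (norm_nonneg a).trans ha
  induction k with
  | zero => simp
  | succ n ih =>
    have hid : a ^ (n + 1) - b ^ (n + 1) = a * (a ^ n - b ^ n) + (a - b) * b ^ n := by ring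
    rw [hid]
    calc ‖a * (a ^ n - b ^ n) + (a - b) * b ^ n‖
        ≤ ‖a‖ * ‖a ^ n - b ^ n‖ + ‖a - b‖ * ‖b‖ ^ n := by
          refine (norm_add_le _ _).trans ?_
          rw [norm_mul, norm_mul, norm_pow]
      _ ≤ M * (n * M ^ (n - 1) * ‖a - b‖) + ‖a - b‖ * M ^ n := by gcongr
      _ = (n * (M * M ^ (n - 1)) + M ^ n) * ‖a - b‖ := by ring
      _ ≤ (n * M ^ n + M ^ n) * ‖a - b‖ := by
          rcases n with _ | n
          · simp
          · gcongr
            rw [Nat.add_sub_cancel, ← pow_succ']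
      _ = ((n + 1 : ℕ) : ℝ) * M ^ (n + 1 - 1) * ‖a - b‖ := by
          rw [Nat.add_sub_cancel]; push_cast; ring

section Contraction2

variable {k : ℕ} {εb : ℂ} {uh : ℂ → ℂ} {X : ℂ × ℂ → ℂ →L[ℝ] ℂ × ℂ}

/-- **`T_s` maps the box into itself** (under explicit smallness conditions on `r = |s|`).
[cite: Wendl2020, App. B, Lemmas B.31–B.35] -/
theorem mapsTo_box {Cu ρ₁ CX δX L δ : ℝ} (hCu : 0 ≤ Cu) (hCX : 0 ≤ CX) (hL : 0 ≤ L)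
    (hu0 : ∀ w ∈ ball (0 : ℂ) ρ₁, ‖uh w‖ ≤ Cu * ‖w‖ ^ (k + 1))
    (huL : ∀ r : ℝ, 4 * r < ρ₁ → ∀ w ∈ closedBall (0 : ℂ) (2 * r), ∀ w' ∈ closedBall (0 : ℂ) (2 * r),
      ‖uh w - uh w'‖ ≤ Cu * (2 * r) ^ k * ‖w - w'‖)
    (hX1 : ∀ x ∈ closedBall (0 : ℂ × ℂ) δX, ∀ w, ‖X x w - (0, w)‖ ≤ CX * ‖x.2‖ * ‖w‖)
    (hLip : ∀ w ∈ ball (1 : ℂ) δ, ∀ w' ∈ ball (1 : ℂ) δ, ‖kroot k w - kroot k w'‖ ≤ L * ‖w - w'‖)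
    (hεn : ‖εb‖ = 1) {s : ℂ} (hs : s ≠ 0) (hr1 : ‖s‖ ≤ 1 / 2) (hrρ : 4 * ‖s‖ < ρ₁)
    (hrδ1 : (2 * ‖s‖) ^ k ≤ δX) (hrδ2 : Cu * (2 * ‖s‖) ^ (k + 1) ≤ δX)
    (hS4 : CX * (Cu * (2 * ‖s‖) ^ (k + 1)) * ((2 * Cu + 1) * ‖s‖ ^ (k + 1)) < δ * ‖s‖ ^ k)
    (hS5 : L * ‖s‖ * (CX * (Cu * (2 * ‖s‖) ^ (k + 1)) * ((2 * Cu + 1) * ‖s‖ ^ (k + 1))) ≤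
      ‖s‖ ^ (k + 2) * ‖s‖ ^ k)
    (hS6 : Cu * (2 * ‖s‖) ^ k * ‖s‖ ^ (k + 2) +
      CX * (Cu * (2 * ‖s‖) ^ (k + 1)) * ((2 * Cu + 1) * ‖s‖ ^ (k + 1)) ≤ ‖s‖ ^ (k + 1)) :
    MapsTo (Tmap k εb uh X s) (box k εb (2 * Cu + 1) s) (box k εb (2 * Cu + 1) s) := by
  intro v hv
  set r : ℝ := ‖s‖ with hr
  set b : ℝ := 2 * Cu + 1 with hb
  set A : ℝ := CX * (Cu * (2 * r) ^ (k + 1)) * (b * r ^ (k + 1)) with hA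
  obtain ⟨hθup, -, -, -, -, ha, hX2η⟩ := box_pointwise hCu hCX hu0 hX1 hεn hr1 hrρ hrδ1 hrδ2 hv
  obtain ⟨hθ, hη⟩ := mem_box.1 hv
  have hr0 : 0 < r := norm_pos_iff.2 hs
  have hrk : 0 < r ^ k := pow_pos hr0 k
  have hεs : ‖εb * s‖ = r := by rw [norm_mul, hεn, one_mul]
  rw [mem_box]
  constructor
  · -- first component: the root branch stays within `r^{k+2}` of `ε̄ s`
    show ‖root k εb s (X (pt k uh v.1) v.2).1 - εb * s‖ ≤ r ^ (k + 2)
    have ha' : ‖(X (pt k uh v.1) v.2).1‖ < δ * r ^ k := ha.trans_lt hS4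
    have h0 : ‖(0 : ℂ)‖ < δ * r ^ k := by
      rw [norm_zero]; exact (le_trans (by positivity) ha).trans_lt hS4
    have h := norm_root_sub_root_le hLip hεn hs ha' h0
    rw [root_zero k εb hs, sub_zero] at h
    have h2 : ‖root k εb s (X (pt k uh v.1) v.2).1 - εb * s‖ * r ^ k ≤ r ^ (k + 2) * r ^ k :=
      h.trans ((mul_le_mul_of_nonneg_left ha (by positivity)).trans hS5)
    exact le_of_mul_le_mul_right h2 hrk
  · -- second component
    show ‖uh s - uh v.1 - ((X (pt k uh v.1) v.2).2 - v.2)‖ ≤ b * r ^ (k + 1)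
    have hsball : s ∈ ball (0 : ℂ) ρ₁ := by rw [mem_ball, dist_zero_right]; linarith
    have hεsball : εb * s ∈ ball (0 : ℂ) ρ₁ := by rw [mem_ball, dist_zero_right, hεs]; linarith
    have hus : ‖uh s‖ ≤ Cu * r ^ (k + 1) := hu0 s hsball
    have huεs : ‖uh (εb * s)‖ ≤ Cu * r ^ (k + 1) := by
      have := hu0 _ hεsball; rwa [hεs] at this
    have hLipu : ‖uh (εb * s) - uh v.1‖ ≤ Cu * (2 * r) ^ k * r ^ (k + 2) := by
      have h1 : εb * s ∈ closedBall (0 : ℂ) (2 * r) := by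
        rw [mem_closedBall, dist_zero_right, hεs]; linarith
      have h2 : v.1 ∈ closedBall (0 : ℂ) (2 * r) := by
        rw [mem_closedBall, dist_zero_right]; exact hθup
      calc ‖uh (εb * s) - uh v.1‖ ≤ Cu * (2 * r) ^ k * ‖εb * s - v.1‖ := huL r hrρ _ h1 _ h2
        _ ≤ Cu * (2 * r) ^ k * r ^ (k + 2) := by gcongr; rwa [norm_sub_rev]
    calc ‖uh s - uh v.1 - ((X (pt k uh v.1) v.2).2 - v.2)‖
        ≤ ‖uh s‖ + ‖uh v.1‖ + ‖(X (pt k uh v.1) v.2).2 - v.2‖ := by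
          refine (norm_sub_le _ _).trans ?_; gcongr; exact norm_sub_le _ _
      _ ≤ Cu * r ^ (k + 1) + (Cu * r ^ (k + 1) + Cu * (2 * r) ^ k * r ^ (k + 2)) + A := by
          gcongr
          calc ‖uh v.1‖ = ‖uh (εb * s) - (uh (εb * s) - uh v.1)‖ := by rw [sub_sub_cancel]
            _ ≤ ‖uh (εb * s)‖ + ‖uh (εb * s) - uh v.1‖ := norm_sub_le _ _
            _ ≤ _ := add_le_add huεs hLipu
      _ = 2 * Cu * r ^ (k + 1) + (Cu * (2 * r) ^ k * r ^ (k + 2) + A) := by ring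
      _ ≤ 2 * Cu * r ^ (k + 1) + r ^ (k + 1) := by gcongr
      _ = b * r ^ (k + 1) := by rw [hb]; ring

end Contraction2

section Contraction3

variable {k : ℕ} {εb : ℂ} {uh : ℂ → ℂ} {X : ℂ × ℂ → ℂ →L[ℝ] ℂ × ℂ}

/-- **`T_s` is a `½`-contraction on the box** (under explicit smallness conditions on `r = |s|`).
[cite: Wendl2020, App. B, Lemmas B.31–B.35] -/
theorem contraction_box {Cu ρ₁ CX δX L δ : ℝ} (hCu : 0 ≤ Cu) (hCX : 0 ≤ CX) (hL : 0 ≤ L)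
    (hu0 : ∀ w ∈ ball (0 : ℂ) ρ₁, ‖uh w‖ ≤ Cu * ‖w‖ ^ (k + 1))
    (huL : ∀ r : ℝ, 4 * r < ρ₁ → ∀ w ∈ closedBall (0 : ℂ) (2 * r), ∀ w' ∈ closedBall (0 : ℂ) (2 * r),
      ‖uh w - uh w'‖ ≤ Cu * (2 * r) ^ k * ‖w - w'‖)
    (hX1 : ∀ x ∈ closedBall (0 : ℂ × ℂ) δX, ∀ w, ‖X x w - (0, w)‖ ≤ CX * ‖x.2‖ * ‖w‖)
    (hX2 : ∀ x ∈ closedBall (0 : ℂ × ℂ) δX, ∀ x' ∈ closedBall (0 : ℂ × ℂ) δX, ∀ w,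
      ‖X x w - X x' w‖ ≤ CX * ‖x - x'‖ * ‖w‖)
    (hLip : ∀ w ∈ ball (1 : ℂ) δ, ∀ w' ∈ ball (1 : ℂ) δ, ‖kroot k w - kroot k w'‖ ≤ L * ‖w - w'‖)
    (hεn : ‖εb‖ = 1) {s : ℂ} (hs : s ≠ 0) (hr1 : ‖s‖ ≤ 1 / 2) (hrρ : 4 * ‖s‖ < ρ₁)
    (hrδ1 : (2 * ‖s‖) ^ k ≤ δX) (hrδ2 : Cu * (2 * ‖s‖) ^ (k + 1) ≤ δX)
    (hS4 : CX * (Cu * (2 * ‖s‖) ^ (k + 1)) * ((2 * Cu + 1) * ‖s‖ ^ (k + 1)) < δ * ‖s‖ ^ k)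
    (hS7 : L * ‖s‖ * (CX * (k * (2 * ‖s‖) ^ (k - 1) + Cu * (2 * ‖s‖) ^ k) *
        ((2 * Cu + 1) * ‖s‖ ^ (k + 1)) + CX * (Cu * (2 * ‖s‖) ^ (k + 1))) ≤ ‖s‖ ^ k / 2)
    (hS8 : Cu * (2 * ‖s‖) ^ k + CX * (k * (2 * ‖s‖) ^ (k - 1) + Cu * (2 * ‖s‖) ^ k) *
        ((2 * Cu + 1) * ‖s‖ ^ (k + 1)) + CX * (Cu * (2 * ‖s‖) ^ (k + 1)) ≤ 1 / 2)
    {v v' : ℂ × ℂ} (hv : v ∈ box k εb (2 * Cu + 1) s) (hv' : v' ∈ box k εb (2 * Cu + 1) s) :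
    dist (Tmap k εb uh X s v) (Tmap k εb uh X s v') ≤ dist v v' / 2 := by
  set r : ℝ := ‖s‖ with hr
  set b : ℝ := 2 * Cu + 1 with hb
  set Cp : ℝ := k * (2 * r) ^ (k - 1) + Cu * (2 * r) ^ k with hCp
  set p := pt k uh v.1 with hp
  set p' := pt k uh v'.1 with hp'
  obtain ⟨hθup, -, -, -, hpmem, ha, -⟩ := box_pointwise hCu hCX hu0 hX1 hεn hr1 hrρ hrδ1 hrδ2 hv
  obtain ⟨hθup', -, -, hp2', hpmem', ha', -⟩ :=
    box_pointwise hCu hCX hu0 hX1 hεn hr1 hrρ hrδ1 hrδ2 hv'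
  obtain ⟨-, hη⟩ := mem_box.1 hv
  have hr0 : 0 < r := norm_pos_iff.2 hs
  have hrk : 0 < r ^ k := pow_pos hr0 k
  set d : ℝ := dist v v' with hd
  have hdθ : ‖v.1 - v'.1‖ ≤ d := by rw [hd, Prod.dist_eq, ← dist_eq_norm]; exact le_max_left _ _
  have hdη : ‖v.2 - v'.2‖ ≤ d := by rw [hd, Prod.dist_eq, ← dist_eq_norm]; exact le_max_right _ _
  have hd0 : 0 ≤ d := dist_nonneg
  -- `‖p - p'‖ ≤ Cp |Δθ|`
  have hθmem : v.1 ∈ closedBall (0 : ℂ) (2 * r) := by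
    rw [mem_closedBall, dist_zero_right]; exact hθup
  have hθmem' : v'.1 ∈ closedBall (0 : ℂ) (2 * r) := by
    rw [mem_closedBall, dist_zero_right]; exact hθup'
  have hpp : ‖p - p'‖ ≤ Cp * ‖v.1 - v'.1‖ := by
    rw [hp, hp', pt, pt, Prod.mk_sub_mk, Prod.norm_mk, max_le_iff]
    constructor
    · calc ‖v.1 ^ k - v'.1 ^ k‖ ≤ k * (2 * r) ^ (k - 1) * ‖v.1 - v'.1‖ :=
            norm_pow_sub_pow_le hθup hθup' k
        _ ≤ Cp * ‖v.1 - v'.1‖ := by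
            gcongr; rw [hCp]; linarith [mul_nonneg hCu (pow_nonneg (by positivity : (0:ℝ) ≤ 2 * r) k)]
    · calc ‖uh v.1 - uh v'.1‖ ≤ Cu * (2 * r) ^ k * ‖v.1 - v'.1‖ := huL r hrρ _ hθmem _ hθmem'
        _ ≤ Cp * ‖v.1 - v'.1‖ := by
            gcongr; rw [hCp]
            linarith [mul_nonneg (Nat.cast_nonneg k) (pow_nonneg (by positivity : (0:ℝ) ≤ 2 * r) (k - 1))]
  -- the two error terms
  have hE1 : ‖X p v.2 - X p' v.2‖ ≤ CX * (Cp * d) * (b * r ^ (k + 1)) := by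
    calc ‖X p v.2 - X p' v.2‖ ≤ CX * ‖p - p'‖ * ‖v.2‖ := hX2 _ hpmem _ hpmem' _
      _ ≤ CX * (Cp * ‖v.1 - v'.1‖) * (b * r ^ (k + 1)) := by gcongr
      _ ≤ CX * (Cp * d) * (b * r ^ (k + 1)) := by gcongr
  have hE2 : ‖X p' (v.2 - v'.2) - (0, v.2 - v'.2)‖ ≤ CX * (Cu * (2 * r) ^ (k + 1)) * d := by
    calc ‖X p' (v.2 - v'.2) - (0, v.2 - v'.2)‖ ≤ CX * ‖p'.2‖ * ‖v.2 - v'.2‖ := hX1 _ hpmem' _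
      _ ≤ CX * (Cu * (2 * r) ^ (k + 1)) * d := by gcongr
  -- the decomposition `X p η - X p' η' = (X p η - X p' η) + X p' (η - η')`
  have hsplit : X p v.2 - X p' v'.2 = (X p v.2 - X p' v.2) + (X p' (v.2 - v'.2) - (0, v.2 - v'.2)) +
      (0, v.2 - v'.2) := by
    rw [map_sub]; abel
  have hfst : ‖(X p v.2).1 - (X p' v'.2).1‖ ≤
      CX * (Cp * d) * (b * r ^ (k + 1)) + CX * (Cu * (2 * r) ^ (k + 1)) * d := by
    have : (X p v.2).1 - (X p' v'.2).1 = (X p v.2 - X p' v.2).1 +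
        (X p' (v.2 - v'.2) - (0, v.2 - v'.2)).1 := by
      have h := congrArg Prod.fst hsplit
      simp only [Prod.fst_sub, Prod.fst_add, add_zero] at h
      rw [← Prod.fst_sub]; exact h.trans (by simp)
    rw [this]
    exact (norm_add_le _ _).trans (add_le_add ((norm_fst_le _).trans hE1) ((norm_fst_le _).trans hE2))
  have hsnd : ‖((X p v.2).2 - v.2) - ((X p' v'.2).2 - v'.2)‖ ≤
      CX * (Cp * d) * (b * r ^ (k + 1)) + CX * (Cu * (2 * r) ^ (k + 1)) * d := by
    have : ((X p v.2).2 - v.2) - ((X p' v'.2).2 - v'.2) = (X p v.2 - X p' v.2).2 +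
        (X p' (v.2 - v'.2) - (0, v.2 - v'.2)).2 := by
      have h := congrArg Prod.snd hsplit
      simp only [Prod.snd_sub, Prod.snd_add] at h ⊢
      linear_combination h
    rw [this]
    exact (norm_add_le _ _).trans (add_le_add ((norm_snd_le _).trans hE1) ((norm_snd_le _).trans hE2))
  -- ### the two components of `T_s v - T_s v'`
  rw [Prod.dist_eq, max_le_iff]
  constructor
  · -- root component
    rw [dist_eq_norm]
    show ‖root k εb s (X p v.2).1 - root k εb s (X p' v'.2).1‖ ≤ d / 2
    have h1 : ‖(X p v.2).1‖ < δ * r ^ k := ha.trans_lt hS4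
    have h2 : ‖(X p' v'.2).1‖ < δ * r ^ k := ha'.trans_lt hS4
    have h := norm_root_sub_root_le hLip hεn hs h1 h2
    have h3 : ‖root k εb s (X p v.2).1 - root k εb s (X p' v'.2).1‖ * r ^ k ≤ d / 2 * r ^ k := by
      calc _ ≤ L * r * ‖(X p v.2).1 - (X p' v'.2).1‖ := h
        _ ≤ L * r * (CX * (Cp * d) * (b * r ^ (k + 1)) + CX * (Cu * (2 * r) ^ (k + 1)) * d) := by
            gcongr
        _ = d * (L * r * (CX * Cp * (b * r ^ (k + 1)) + CX * (Cu * (2 * r) ^ (k + 1)))) := by ring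
        _ ≤ d * (r ^ k / 2) := by gcongr
        _ = d / 2 * r ^ k := by ring
    exact le_of_mul_le_mul_right h3 hrk
  · -- normal component
    rw [dist_eq_norm]
    show ‖uh s - uh v.1 - ((X p v.2).2 - v.2) - (uh s - uh v'.1 - ((X p' v'.2).2 - v'.2))‖ ≤ d / 2
    have hid : uh s - uh v.1 - ((X p v.2).2 - v.2) - (uh s - uh v'.1 - ((X p' v'.2).2 - v'.2)) =
        -(uh v.1 - uh v'.1) - (((X p v.2).2 - v.2) - ((X p' v'.2).2 - v'.2)) := by ring
    rw [hid]
    calc ‖-(uh v.1 - uh v'.1) - (((X p v.2).2 - v.2) - ((X p' v'.2).2 - v'.2))‖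
        ≤ ‖uh v.1 - uh v'.1‖ + ‖((X p v.2).2 - v.2) - ((X p' v'.2).2 - v'.2)‖ := by
          refine (norm_sub_le _ _).trans ?_; rw [norm_neg]
      _ ≤ Cu * (2 * r) ^ k * ‖v.1 - v'.1‖ +
          (CX * (Cp * d) * (b * r ^ (k + 1)) + CX * (Cu * (2 * r) ^ (k + 1)) * d) :=
          add_le_add (huL r hrρ _ hθmem _ hθmem') hsnd
      _ ≤ Cu * (2 * r) ^ k * d +
          (CX * (Cp * d) * (b * r ^ (k + 1)) + CX * (Cu * (2 * r) ^ (k + 1)) * d) := by gcongr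
      _ = d * (Cu * (2 * r) ^ k + CX * Cp * (b * r ^ (k + 1)) + CX * (Cu * (2 * r) ^ (k + 1))) := by
          ring
      _ ≤ d * (1 / 2) := by gcongr
      _ = d / 2 := by ring

end Contraction3

section Solution

variable {k : ℕ} {εb : ℂ} {uh : ℂ → ℂ} {X : ℂ × ℂ → ℂ →L[ℝ] ℂ × ℂ}

/-- **Smallness.** All the smallness conditions of `mapsTo_box` and `contraction_box` hold for
`0 < |s| < ε₀`. [folklore] -/
theorem exists_eps_small (hk : k ≠ 0) {Cu ρ₁ CX δX L δ : ℝ} (hCu : 0 ≤ Cu) (hCX : 0 ≤ CX)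
    (hρ₁ : 0 < ρ₁) (hδX : 0 < δX) (hδ : 0 < δ) :
    ∃ ε₀ : ℝ, 0 < ε₀ ∧ ∀ s : ℂ, s ≠ 0 → ‖s‖ < ε₀ →
      ‖s‖ ≤ 1 / 2 ∧ 4 * ‖s‖ < ρ₁ ∧ (2 * ‖s‖) ^ k ≤ δX ∧ Cu * (2 * ‖s‖) ^ (k + 1) ≤ δX ∧
      CX * (Cu * (2 * ‖s‖) ^ (k + 1)) * ((2 * Cu + 1) * ‖s‖ ^ (k + 1)) < δ * ‖s‖ ^ k ∧
      L * ‖s‖ * (CX * (Cu * (2 * ‖s‖) ^ (k + 1)) * ((2 * Cu + 1) * ‖s‖ ^ (k + 1))) ≤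
        ‖s‖ ^ (k + 2) * ‖s‖ ^ k ∧
      Cu * (2 * ‖s‖) ^ k * ‖s‖ ^ (k + 2) +
        CX * (Cu * (2 * ‖s‖) ^ (k + 1)) * ((2 * Cu + 1) * ‖s‖ ^ (k + 1)) ≤ ‖s‖ ^ (k + 1) ∧
      L * ‖s‖ * (CX * (k * (2 * ‖s‖) ^ (k - 1) + Cu * (2 * ‖s‖) ^ k) *
        ((2 * Cu + 1) * ‖s‖ ^ (k + 1)) + CX * (Cu * (2 * ‖s‖) ^ (k + 1))) ≤ ‖s‖ ^ k / 2 ∧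
      Cu * (2 * ‖s‖) ^ k + CX * (k * (2 * ‖s‖) ^ (k - 1) + Cu * (2 * ‖s‖) ^ k) *
        ((2 * Cu + 1) * ‖s‖ ^ (k + 1)) + CX * (Cu * (2 * ‖s‖) ^ (k + 1)) ≤ 1 / 2 := by
  set K₄ : ℝ := CX * Cu * 2 ^ (k + 1) * (2 * Cu + 1) with hK₄
  have hK₄0 : 0 ≤ K₄ := by positivity
  -- the continuous majorants, all vanishing at `0`
  set f₁ : ℝ → ℝ := fun r => (2 * r) ^ k with hf₁
  set f₂ : ℝ → ℝ := fun r => Cu * (2 * r) ^ (k + 1) with hf₂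
  set f₄ : ℝ → ℝ := fun r => K₄ * r ^ (k + 2) with hf₄
  set f₅ : ℝ → ℝ := fun r => L * K₄ * r with hf₅
  set f₆ : ℝ → ℝ := fun r => Cu * 2 ^ k * r ^ (k + 1) + K₄ * r ^ (k + 1) with hf₆
  set f₇ : ℝ → ℝ := fun r => L * r ^ 2 *
    (CX * (k * (2 * r) ^ (k - 1) + Cu * (2 * r) ^ k) * (2 * Cu + 1) + CX * Cu * 2 ^ (k + 1))
    with hf₇
  set f₈ : ℝ → ℝ := fun r => Cu * (2 * r) ^ k +
    CX * (k * (2 * r) ^ (k - 1) + Cu * (2 * r) ^ k) * ((2 * Cu + 1) * r ^ (k + 1)) +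
      CX * (Cu * (2 * r) ^ (k + 1)) with hf₈
  have ev : ∀ {f : ℝ → ℝ} {c : ℝ}, Continuous f → f 0 < c → ∀ᶠ r in 𝓝 (0 : ℝ), f r < c :=
    fun hf h0 => (hf.tendsto 0).eventually_lt_const h0
  have hk1 : k + 1 ≠ 0 := by omega
  have e₀ : ∀ᶠ r in 𝓝 (0 : ℝ), r < min (1 / 2) (ρ₁ / 4) :=
    ev continuous_id (by simp [hρ₁])
  have e₁ : ∀ᶠ r in 𝓝 (0 : ℝ), f₁ r < δX := ev (by fun_prop) (by simp [hf₁, hk, hδX])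
  have e₂ : ∀ᶠ r in 𝓝 (0 : ℝ), f₂ r < δX := ev (by fun_prop) (by simp [hf₂, hδX])
  have e₄ : ∀ᶠ r in 𝓝 (0 : ℝ), f₄ r < δ := ev (by fun_prop) (by simp [hf₄, hδ])
  have e₅ : ∀ᶠ r in 𝓝 (0 : ℝ), f₅ r < 1 := ev (by fun_prop) (by simp [hf₅])
  have e₆ : ∀ᶠ r in 𝓝 (0 : ℝ), f₆ r < 1 := ev (by fun_prop) (by simp [hf₆])
  have e₇ : ∀ᶠ r in 𝓝 (0 : ℝ), f₇ r < 1 / 2 := ev (by fun_prop) (by simp [hf₇])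
  have e₈ : ∀ᶠ r in 𝓝 (0 : ℝ), f₈ r < 1 / 2 := ev (by fun_prop) (by simp [hf₈, hk])
  obtain ⟨ε₀, hε₀, hall⟩ := Metric.eventually_nhds_iff.1
    (e₀.and (e₁.and (e₂.and (e₄.and (e₅.and (e₆.and (e₇.and e₈)))))))
  refine ⟨ε₀, hε₀, fun s hs hsε => ?_⟩
  set r : ℝ := ‖s‖ with hr
  have hr0 : 0 < r := norm_pos_iff.2 hs
  have hrk : 0 < r ^ k := pow_pos hr0 k
  obtain ⟨h₀, h₁, h₂, h₄, h₅, h₆, h₇, h₈⟩ := hall (y := r) (by simpa [hr] using hsε)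
  have hr12 : r ≤ 1 / 2 := (h₀.trans_le (min_le_left _ _)).le
  have hrρ : 4 * r < ρ₁ := by linarith [h₀.trans_le (min_le_right _ _)]
  -- the common quantity `A = K₄ r^{k+1} r^{k+1}`
  have hA : CX * (Cu * (2 * r) ^ (k + 1)) * ((2 * Cu + 1) * r ^ (k + 1)) =
      K₄ * r ^ (k + 1) * r ^ (k + 1) := by rw [hK₄]; ring
  refine ⟨hr12, hrρ, h₁.le, h₂.le, ?_, ?_, ?_, ?_, h₈.le⟩
  · rw [hA]
    calc K₄ * r ^ (k + 1) * r ^ (k + 1) = (K₄ * r ^ (k + 2)) * r ^ k := by ring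
      _ < δ * r ^ k := by gcongr
  · rw [hA]
    calc L * r * (K₄ * r ^ (k + 1) * r ^ (k + 1)) = (L * K₄ * r) * (r ^ (k + 2) * r ^ k) := by ring
      _ ≤ 1 * (r ^ (k + 2) * r ^ k) := by gcongr
      _ = r ^ (k + 2) * r ^ k := one_mul _
  · rw [hA]
    calc Cu * (2 * r) ^ k * r ^ (k + 2) + K₄ * r ^ (k + 1) * r ^ (k + 1)
        = (Cu * 2 ^ k * r ^ (k + 1) + K₄ * r ^ (k + 1)) * r ^ (k + 1) := by ring
      _ ≤ 1 * r ^ (k + 1) := by gcongr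
      _ = r ^ (k + 1) := one_mul _
  · calc L * r * (CX * (k * (2 * r) ^ (k - 1) + Cu * (2 * r) ^ k) * ((2 * Cu + 1) * r ^ (k + 1)) +
          CX * (Cu * (2 * r) ^ (k + 1))) = f₇ r * r ^ k := by rw [hf₇]; ring
      _ ≤ 1 / 2 * r ^ k := by gcongr
      _ = r ^ k / 2 := by ring

/-- **Existence and uniqueness of the rotated branch** (Wendl 2020, Lemma B.35, quantitative
fixed-point form; see the module docstring). For `0 < |s| < ε₀`: `T_s` maps the box
`|θ - ε̄ s| ≤ |s|^{k+2}`, `|η| ≤ (2C_u + 1)|s|^{k+1}` into itself, is a `½`-contraction there, has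
a unique fixed point in it, and every fixed point solves (B.20):
`θᵏ + X̌_η(θᵏ, û θ) = sᵏ`, `û θ + X̂_η(θᵏ, û θ) = û s`.
[cite: Wendl2020, App. B, (B.20), Lemmas B.31 and B.35] -/
theorem exists_branchSolution (hk : k ≠ 0) (hε : εb ^ k = 1) (hεn : ‖εb‖ = 1)
    {Cu ρ₁ CX δX : ℝ} (hCu : 0 ≤ Cu) (hCX : 0 ≤ CX) (hρ₁ : 0 < ρ₁) (hδX : 0 < δX)
    (hu0 : ∀ w ∈ ball (0 : ℂ) ρ₁, ‖uh w‖ ≤ Cu * ‖w‖ ^ (k + 1))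
    (huL : ∀ r : ℝ, 4 * r < ρ₁ → ∀ w ∈ closedBall (0 : ℂ) (2 * r), ∀ w' ∈ closedBall (0 : ℂ) (2 * r),
      ‖uh w - uh w'‖ ≤ Cu * (2 * r) ^ k * ‖w - w'‖)
    (hX1 : ∀ x ∈ closedBall (0 : ℂ × ℂ) δX, ∀ w, ‖X x w - (0, w)‖ ≤ CX * ‖x.2‖ * ‖w‖)
    (hX2 : ∀ x ∈ closedBall (0 : ℂ × ℂ) δX, ∀ x' ∈ closedBall (0 : ℂ × ℂ) δX, ∀ w,
      ‖X x w - X x' w‖ ≤ CX * ‖x - x'‖ * ‖w‖) :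
    ∃ ε₀ : ℝ, 0 < ε₀ ∧ ∀ s : ℂ, s ≠ 0 → ‖s‖ < ε₀ →
      ‖s‖ ≤ 1 / 2 ∧ 4 * ‖s‖ < ρ₁ ∧ (2 * ‖s‖) ^ k ≤ δX ∧ Cu * (2 * ‖s‖) ^ (k + 1) ≤ δX ∧
      MapsTo (Tmap k εb uh X s) (box k εb (2 * Cu + 1) s) (box k εb (2 * Cu + 1) s) ∧
      (∀ v ∈ box k εb (2 * Cu + 1) s, ∀ v' ∈ box k εb (2 * Cu + 1) s,
        dist (Tmap k εb uh X s v) (Tmap k εb uh X s v') ≤ dist v v' / 2) ∧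
      (∃ v ∈ box k εb (2 * Cu + 1) s, Tmap k εb uh X s v = v) ∧
      (∀ v ∈ box k εb (2 * Cu + 1) s, ∀ v' ∈ box k εb (2 * Cu + 1) s,
        Tmap k εb uh X s v = v → Tmap k εb uh X s v' = v' → v = v') ∧
      (∀ v ∈ box k εb (2 * Cu + 1) s, Tmap k εb uh X s v = v →
        v.1 ^ k + (X (pt k uh v.1) v.2).1 = s ^ k ∧ uh v.1 + (X (pt k uh v.1) v.2).2 = uh s) := by
  obtain ⟨L, δ, hL, hδ, hδ1, hLip, -⟩ := exists_kroot_lipschitz k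
  obtain ⟨ε₀, hε₀, hsmall⟩ := exists_eps_small (Cu := Cu) (CX := CX) (L := L) hk hCu hCX hρ₁ hδX hδ
  refine ⟨ε₀, hε₀, fun s hs hsε => ?_⟩
  obtain ⟨hr1, hrρ, hrδ1, hrδ2, hS4, hS5, hS6, hS7, hS8⟩ := hsmall s hs hsε
  have hmaps : MapsTo (Tmap k εb uh X s) (box k εb (2 * Cu + 1) s) (box k εb (2 * Cu + 1) s) :=
    mapsTo_box hCu hCX hL hu0 huL hX1 hLip hεn hs hr1 hrρ hrδ1 hrδ2 hS4 hS5 hS6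
  have hcontr : ∀ v ∈ box k εb (2 * Cu + 1) s, ∀ v' ∈ box k εb (2 * Cu + 1) s,
      dist (Tmap k εb uh X s v) (Tmap k εb uh X s v') ≤ dist v v' / 2 := fun v hv v' hv' =>
    contraction_box hCu hCX hL hu0 huL hX1 hX2 hLip hεn hs hr1 hrρ hrδ1 hrδ2 hS4 hS7 hS8 hv hv'
  have huniq : ∀ v ∈ box k εb (2 * Cu + 1) s, ∀ v' ∈ box k εb (2 * Cu + 1) s,
      Tmap k εb uh X s v = v → Tmap k εb uh X s v' = v' → v = v' := by
    intro v hv v' hv' h h'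
    have := hcontr v hv v' hv'
    rw [h, h'] at this
    exact dist_le_zero.1 (by linarith [dist_nonneg (x := v) (y := v')])
  refine ⟨hr1, hrρ, hrδ1, hrδ2, hmaps, hcontr, ?_, huniq, fun v hv hfix => ?_⟩
  · -- existence: Banach fixed point on the complete box
    set B := box k εb (2 * Cu + 1) s with hB
    have hcomplete : IsComplete B := (isClosed_box (2 * Cu + 1) s).isComplete
    have hK : ContractingWith (1 / 2 : NNReal) (hmaps.restrict (Tmap k εb uh X s) B B) := by
      refine ⟨by norm_num, LipschitzWith.of_dist_le_mul fun x y => ?_⟩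
      have := hcontr x x.2 y y.2
      rw [Subtype.dist_eq]
      push_cast
      simpa [MapsTo.restrict, Subtype.dist_eq, div_eq_inv_mul, mul_comm] using this
    have h0 : ((εb * s, (0 : ℂ)) : ℂ × ℂ) ∈ B := by
      rw [hB, mem_box]; constructor <;> simp; positivity
    obtain ⟨v, hvB, hfix, -⟩ := hK.exists_fixedPoint' hcomplete hmaps h0 (edist_ne_top _ _)
    exact ⟨v, hvB, hfix⟩
  · -- the equations
    obtain ⟨-, -, -, -, -, ha, -⟩ := box_pointwise hCu hCX hu0 hX1 hεn hr1 hrρ hrδ1 hrδ2 hv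
    refine equations_of_fixedPoint hk hε hs hfix fun h0 => ?_
    have h1 : ‖(X (pt k uh v.1) v.2).1‖ < δ * ‖s‖ ^ k := ha.trans_lt hS4
    have h2 : (X (pt k uh v.1) v.2).1 = s ^ k := (sub_eq_zero.1 h0).symm
    rw [h2, norm_pow] at h1
    have : δ * ‖s‖ ^ k ≤ 1 * ‖s‖ ^ k := by gcongr
    linarith

end Solution

end Literature.Geometry.Symplectic.RotationBranch

end
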